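import Mathlib
import Literature.Computability.AlgebraicComplexity.MignonRessayreBound
import Summits.ValiantsHypothesis.ValiantsHypothesis.Theorems.GrenetZeonTwoDimCoefficientsDualJet

/-!
# Crux `GrenetZeon.TwoDimCoefficients` (stmt-ValiantsHypothesis-8062), line `dim2_cases` —
# top homogeneous forms of products, powers and determinants; Hessian of `f^{k+1} g`

Generic plumbing (route-independent) for the provable half `UnitDichotomyTop` of the registered stub
`stub_unitDichotomy` (see the crux workfile `UNIT-CASE-NOTE.md` and the companion file
`GrenetZeonTwoDimCoefficientsUnitTop.lean`):

* `homogeneousComponent_mul_of_le`, `homogeneousComponent_prod_of_le`,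
  `homogeneousComponent_pow_of_le` — the homogeneous component of a product in the sum of degree
  BOUNDS is the product of the components ("top forms multiply", with slack);
* `homogeneousComponent_det_of_le`, `totalDegree_det_le` — for a square matrix of polynomials of
  degree `≤ D`, the component of `det` in degree `card · D` is the determinant of the componentwise
  degree-`D` parts, and `deg det ≤ card · D`;
* `homogeneousComponent_totalDegree_ne_zero`, `totalDegree_eq_of_homogeneousComponent_ne_zero`,
  `totalDegree_pow_of_ne_zero` — bookkeeping of top components;
* `rank_le_rank_smul_add_symm_add_two` — `rank M ≤ rank (c • M + (u aᵀ + a uᵀ)) + 2` (`c ≠ 0`);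
* `hess0_pow_succ_mul` — the Hessian at the origin of `f^{k+1} g` is
  `f(0)^k • ((k+1) g(0) • H f + f(0) • H g)` plus a symmetrised rank-`≤ 2` term `∇f aᵀ + a ∇fᵀ`
  (iterated product rule `hess0_mul` of the tree).

HONEST FRAMING: commutative-algebra / linear-algebra plumbing; nothing here bears on `VP ≠ VNP`.

References: standard (graded rings: D. Eisenbud, *Commutative Algebra*, GTM 150, §1.5); the
Hessian-at-the-origin calculus is the tree's `Literature/Computability/AlgebraicComplexity/HessianAtOrigin.lean`.
-/

-- single-conjunct layout `Summits/ValiantsHypothesis/ValiantsHypothesis`: the duplicated namespace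
-- component is mandated by the tree.
set_option linter.dupNamespace false

noncomputable section

open MvPolynomial Matrix
open Literature.Computability.AlgebraicComplexity

namespace Summit.ValiantsHypothesis.ValiantsHypothesis.Theorems.GrenetZeonTwoDimCoefficients

/-! ### Top forms of products, powers, determinants -/

section TopForms

variable {σ : Type*} {K : Type*} [Field K]

/-- The component of `f g` in degree `D + E` is `f_D g_E` whenever `deg f ≤ D`, `deg g ≤ E`.
[folklore] -/
theorem homogeneousComponent_mul_of_le {f g : MvPolynomial σ K} {D E : ℕ}
    (hf : f.totalDegree ≤ D) (hg : g.totalDegree ≤ E) :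
    homogeneousComponent (D + E) (f * g) = homogeneousComponent D f * homogeneousComponent E g := by
  classical
  ext d
  rw [coeff_homogeneousComponent, coeff_mul, coeff_mul]
  split_ifs with hd
  · refine Finset.sum_congr rfl fun x hx => ?_
    rw [Finset.HasAntidiagonal.mem_antidiagonal] at hx
    rw [coeff_homogeneousComponent, coeff_homogeneousComponent]
    have hdeg : x.1.degree + x.2.degree = D + E := by rw [← map_add, hx, hd]
    by_cases h1 : x.1.degree = D
    · have h2 : x.2.degree = E := by omega
      rw [if_pos h1, if_pos h2]
    · rw [if_neg h1]
      rcases Nat.lt_or_gt_of_ne h1 with hlt | hgt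
      · have h2 : g.totalDegree < x.2.degree := by omega
        have hg0 : coeff x.2 g = 0 :=
          coeff_eq_zero_of_totalDegree_lt (by rw [← Finsupp.degree_apply]; exact h2)
        rw [hg0, mul_zero, zero_mul]
      · have hf0 : coeff x.1 f = 0 :=
          coeff_eq_zero_of_totalDegree_lt (by rw [← Finsupp.degree_apply]; omega)
        rw [hf0, zero_mul, zero_mul]
  · symm
    refine Finset.sum_eq_zero fun x hx => ?_
    rw [Finset.HasAntidiagonal.mem_antidiagonal] at hx
    rw [coeff_homogeneousComponent, coeff_homogeneousComponent]
    split_ifs with h1 h2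
    · exfalso
      apply hd
      rw [← hx, map_add, h1, h2]
    · rw [mul_zero]
    · rw [zero_mul]
    · rw [zero_mul]

/-- Product form of `homogeneousComponent_mul_of_le` over a finset. [folklore] -/
theorem homogeneousComponent_prod_of_le {ι : Type*} (s : Finset ι) (f : ι → MvPolynomial σ K)
    (D : ι → ℕ) (h : ∀ i ∈ s, (f i).totalDegree ≤ D i) :
    homogeneousComponent (∑ i ∈ s, D i) (∏ i ∈ s, f i) =
      ∏ i ∈ s, homogeneousComponent (D i) (f i) := by
  classical
  induction s using Finset.induction_on with
  | empty =>
      rw [Finset.sum_empty, Finset.prod_empty, Finset.prod_empty, homogeneousComponent_zero,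
        coeff_zero_one, C_1]
  | insert a s ha ih =>
      rw [Finset.sum_insert ha, Finset.prod_insert ha, Finset.prod_insert ha,
        homogeneousComponent_mul_of_le (h a (Finset.mem_insert_self a s))
          ((totalDegree_finsetProd s f).trans (Finset.sum_le_sum fun i hi =>
            h i (Finset.mem_insert_of_mem hi))),
        ih fun i hi => h i (Finset.mem_insert_of_mem hi)]

/-- Power form: `(f^r)_{rD} = (f_D)^r` when `deg f ≤ D`. [folklore] -/
theorem homogeneousComponent_pow_of_le {f : MvPolynomial σ K} {D : ℕ} (hf : f.totalDegree ≤ D)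
    (r : ℕ) : homogeneousComponent (r * D) (f ^ r) = homogeneousComponent D f ^ r := by
  induction r with
  | zero => rw [zero_mul, pow_zero, pow_zero, homogeneousComponent_zero, coeff_zero_one, C_1]
  | succ r ih =>
      rw [pow_succ, pow_succ, Nat.succ_mul,
        homogeneousComponent_mul_of_le ((totalDegree_pow f r).trans (Nat.mul_le_mul_left r hf)) hf,
        ih]

/-- For a square matrix of polynomials of degree `≤ D`, the homogeneous component of its
determinant in degree `card · D` is the determinant of the componentwise degree-`D` parts.
[folklore] -/
theorem homogeneousComponent_det_of_le {ι : Type*} [Fintype ι] [DecidableEq ι]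
    (M : Matrix ι ι (MvPolynomial σ K)) {D : ℕ} (hM : ∀ i j, (M i j).totalDegree ≤ D) :
    homogeneousComponent (Fintype.card ι * D) M.det = (M.map (homogeneousComponent D)).det := by
  rw [Matrix.det_apply', Matrix.det_apply', map_sum]
  refine Finset.sum_congr rfl fun τ _ => ?_
  have hcast : ((Equiv.Perm.sign τ : ℤ) : MvPolynomial σ K) = C ((Equiv.Perm.sign τ : ℤ) : K) := by
    rw [map_intCast]
  rw [hcast, homogeneousComponent_C_mul]
  congr 1
  have h := homogeneousComponent_prod_of_le (Finset.univ : Finset ι) (fun i => M (τ i) i)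
    (fun _ => D) (fun i _ => hM (τ i) i)
  rw [Finset.sum_const, Finset.card_univ, smul_eq_mul] at h
  rw [h]
  rfl

/-- `deg det M ≤ card · D` for a square matrix of polynomials of degree `≤ D`. [folklore] -/
theorem totalDegree_det_le {ι : Type*} [Fintype ι] [DecidableEq ι]
    (M : Matrix ι ι (MvPolynomial σ K)) {D : ℕ} (hM : ∀ i j, (M i j).totalDegree ≤ D) :
    M.det.totalDegree ≤ Fintype.card ι * D := by
  rw [Matrix.det_apply']
  refine totalDegree_finsetSum_le fun τ _ => ?_
  refine (totalDegree_mul _ _).trans ?_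
  have hcast : ((Equiv.Perm.sign τ : ℤ) : MvPolynomial σ K) = C ((Equiv.Perm.sign τ : ℤ) : K) := by
    rw [map_intCast]
  rw [hcast, totalDegree_C, zero_add]
  refine (totalDegree_finsetProd _ _).trans ?_
  calc ∑ i, (M (τ i) i).totalDegree ≤ ∑ _i : ι, D := Finset.sum_le_sum fun i _ => hM (τ i) i
    _ = Fintype.card ι * D := by rw [Finset.sum_const, Finset.card_univ, smul_eq_mul]

/-- The top homogeneous component of a non-zero polynomial is non-zero. [folklore] -/
theorem homogeneousComponent_totalDegree_ne_zero {f : MvPolynomial σ K} (hf : f ≠ 0) :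
    homogeneousComponent f.totalDegree f ≠ 0 := by
  classical
  obtain ⟨s, hs, hdeg⟩ := Finset.exists_mem_eq_sup (f.support) (support_nonempty.mpr hf)
    (fun s => s.sum fun _ e => e)
  intro h0
  have hc := congrArg (coeff s) h0
  rw [coeff_homogeneousComponent, coeff_zero, if_pos] at hc
  · exact (mem_support_iff.mp hs) hc
  · rw [Finsupp.degree_apply, totalDegree, hdeg]
    rfl

/-- If a homogeneous component in degree `T ≥ deg f` is non-zero, then `deg f = T`. [folklore] -/
theorem totalDegree_eq_of_homogeneousComponent_ne_zero {f : MvPolynomial σ K} {T : ℕ}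
    (hle : f.totalDegree ≤ T) (hne : homogeneousComponent T f ≠ 0) : f.totalDegree = T := by
  by_contra h
  exact hne (homogeneousComponent_eq_zero T f (lt_of_le_of_ne hle h))

/-- `deg (f^r) = r · deg f` for `f ≠ 0` (polynomials over a field). [folklore] -/
theorem totalDegree_pow_of_ne_zero {f : MvPolynomial σ K} (hf : f ≠ 0) (r : ℕ) :
    (f ^ r).totalDegree = r * f.totalDegree := by
  induction r with
  | zero => rw [pow_zero, totalDegree_one, zero_mul]
  | succ r ih => rw [pow_succ, totalDegree_mul_of_isDomain (pow_ne_zero r hf) hf, ih, Nat.succ_mul]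

end TopForms

/-! ### Rank under a symmetrised rank-two perturbation -/

section RankPerturb

variable {K : Type*} [Field K] {σ : Type*} [Fintype σ]

/-- `rank M ≤ rank (c • M + (u aᵀ + a uᵀ)) + 2` for `c ≠ 0`. [folklore] -/
theorem rank_le_rank_smul_add_symm_add_two {c : K} (hc : c ≠ 0) (M : Matrix σ σ K)
    (u a : σ → K) :
    M.rank ≤ (c • M + (vecMulVec u a + vecMulVec a u)).rank + 2 := by
  have hsplit : c • M = (c • M + (vecMulVec u a + vecMulVec a u)) +
      (-1 : K) • (vecMulVec u a + vecMulVec a u) := by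
    rw [neg_one_smul, add_neg_cancel_right]
  calc M.rank = (c • M).rank := (rank_smul_eq hc M).symm
    _ ≤ (c • M + (vecMulVec u a + vecMulVec a u)).rank +
        ((-1 : K) • (vecMulVec u a + vecMulVec a u)).rank := by
          conv_lhs => rw [hsplit]
          exact rank_add_le _ _
    _ ≤ _ := Nat.add_le_add_left
        ((rank_smul_le _ _).trans (rank_vecMulVec_add_vecMulVec_le u a a u)) _

end RankPerturb

/-! ### The Hessian at the origin of `f^{k+1} · g` -/

section HessPow

variable {K : Type*} [Field K] {σ : Type*}

/-- **Hessian of `f^{k+1} g` at the origin**: it is `f(0)^k • ((k+1) g(0) • H f + f(0) • H g)` up to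
a symmetrised rank-`≤ 2` term `∇f(0) aᵀ + a ∇f(0)ᵀ`. [folklore] -/
theorem hess0_pow_succ_mul (f : MvPolynomial σ K) :
    ∀ (k : ℕ) (g : MvPolynomial σ K), ∃ a : σ → K,
      hess0 (f ^ (k + 1) * g) =
        constantCoeff f ^ k • ((((k + 1 : ℕ) : K) * constantCoeff g) • hess0 f +
          constantCoeff f • hess0 g) +
        (vecMulVec (linPart f) a + vecMulVec a (linPart f)) := by
  intro k
  induction k with
  | zero =>
      intro g
      refine ⟨linPart g, ?_⟩
      rw [zero_add, pow_one, hess0_mul, pow_zero, one_smul, Nat.cast_one, one_mul]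
      abel
  | succ k ih =>
      intro g
      obtain ⟨a', ha'⟩ := ih (f * g)
      refine ⟨constantCoeff f ^ (k + 1) • linPart g + a', ?_⟩
      rw [pow_succ f (k + 1), mul_assoc, ha', map_mul, hess0_mul]
      ext s t
      simp only [Matrix.add_apply, Matrix.smul_apply, vecMulVec_apply, Pi.add_apply,
        Pi.smul_apply, smul_eq_mul]
      push_cast
      ring

end HessPow

end Summit.ValiantsHypothesis.ValiantsHypothesis.Theorems.GrenetZeonTwoDimCoefficients

end
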